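import Summits.QuantumAdvantage.QuantumAdvantage.Theorems.SosSandwichTransferPBSimTreePB
import Literature.Computability.QuantumComplexity.AaronsonAmbainisThm23Queries
import HarnessLib

/-!
# Crux `TransferPB` (stmt-QuantumAdvantage-15238, route SosSandwich), line `birth` — the query half of `stub_pbOracleSimulation` under PB-AA

Toward stub `stub_pbOracleSimulation` (`Sig.stub_oracleAcceptPseudoBounded → PseudoBoundedAA → OracleSimulation`,
Aaronson–Ambainis 2014 Thm. 23 relative to a promise-`BQP` oracle, under PB-AA). Aaronson–Ambainis' proof of
Thm. 23 has a QUERY half — the classical simulation tree of Thm. 21 run on the acceptance polynomial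
`p_x = acceptPoly F x` of the oracle machine approximates `p_x(A)` for all but a small fraction of oracles —
and a MACHINE half (the tree is walked by a polynomial-time machine with the help of an oracle). The tree
proves the query half from the FULL body of Conjecture 6 (`measure_simTreeOn_deviation_lt`,
`AaronsonAmbainisThm23Queries.lean`). This file proves it from the crux's WEAKER antecedent: the PB-AA
influence bound for the SOS sandwich classes `K_T` only, plus `p_x ∈ K_{#oracle gates}` (stub 1 of this
line, `stub_oracleAcceptPseudoBounded`, landed) — the influence hypothesis is only ever applied to
restrictions of `p_x`, which stay in `K_T` (`Theorems/SosSandwichTransferPBSimTreePB.lean`).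

* `card_simTree_acceptPoly_err_le_pb` — for every `ε, δ ∈ (0,1]`: the simulation tree with parameters
  `(ε, δ, d = 2·#gates + 1)` on `p_x ∈ K_{#gates}` errs by `> ε` on at most `δ·2^M` patterns of the `M`
  relevant oracle bits;
* **`measure_simTree_acceptPoly_deviation_le_pb`** — hence `μ {A | |tree(A) − p_x(A)| > ε} ≤ δ` over the
  random oracle (the relevant bits are uniform, `randomOracleMeasure_oracleBits_mem`) — the form with a free
  error budget `δ` that `OracleSimulation` (`≤ 1/(r(n)+1)`) needs;
* `measure_simTreeOn_deviation_lt_pb`, **`measure_simTreeOn_threshold_lt_pb`** — the tree's own explicit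
  tree `simTreeOn c C₀ F x` (`δ = 1/(2n³)`): `Pr_A[|p̃_x(A) − p_x(A)| > 1/10] < 1/n³` and the thresholded
  event of claim (apx), now under PB-AA + `K`-membership instead of Conjecture 6.

What remains for `stub_pbOracleSimulation` is the machine half: a deterministic polynomial-time transcript
machine that walks (a gapped-test-robust variant of) the tree with the combined oracle `A ⊕ g`, `g` answering a
`PromiseBQP` problem that encodes the node tests (expectation / variance / influence thresholds of restricted
acceptance probabilities). All proved here; no named fact.
Source: S. Aaronson, A. Ambainis, Theory Comput. 10 (2014), Thm. 21, Thm. 23 and its proof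
(arXiv:0911.0996v3 pp. 13–14).
-/

-- D-0017: single-conjunct summit ⇒ the duplicate `QuantumAdvantage.QuantumAdvantage` is mandated.
set_option linter.dupNamespace false

noncomputable section

namespace Summit.QuantumAdvantage.QuantumAdvantage.Cruxes.TransferPB.Birth

open Finset MeasureTheory Literature.Computability.Cryptography Literature.Computability.Complexity
  Literature.Computability.QuantumComplexity Literature.Computability.QuantumComplexity.ClassicalSimulation
open scoped ENNReal

namespace SimTreePB

variable {G : QGateSet} {c : ℕ} {C₀ : ℝ} (F : QCircuitFamily G) (x : List Bool)

/-- **Thm. 21 on the acceptance polynomial of an oracle machine, under PB-AA** (counting form): if every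
`q ∈ K_T` (`T ≥ 1`, any number of variables) with `Var[q] ≥ ε' > 0` has a variable of influence
`≥ C₀ (ε'/T)^c`, and `p_x = acceptPoly F x ∈ K_{#oracle gates}`, then for `ε, δ ∈ (0,1]` the simulation tree
with `d = 2·#gates + 1` errs by more than `ε` on at most `δ · 2^M` of the `2^M` relevant bit patterns.
[cite: AaronsonAmbainis2014, Thm. 21 and proof of Thm. 23 (p. 14)] -/
theorem card_simTree_acceptPoly_err_le_pb (hC₀ : 0 < C₀)
    (HPB : ∀ (N T : ℕ) (p : MvPolynomial (Fin N) ℝ) (ε : ℝ), 1 ≤ T → PseudoBounded T p → 0 < ε →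
      ε ≤ boolVariance p → ∃ i : Fin N, C₀ * (ε / T) ^ c ≤ influence i p)
    (hK : PseudoBounded (F.circ x.length).oracleQueries (acceptPoly F x))
    {ε δ : ℝ} (hε : 0 < ε) (hε1 : ε ≤ 1) (hδ : 0 < δ) (hδ1 : δ ≤ 1) :
    ((univ.filter fun b : Fin (numOracleBits F x) → Bool => ε <
        |(simTree (ε ^ 2 * δ / 2) (C₀ * ((ε ^ 2 * δ / 2) / thm23Degree F x) ^ c)
            (Nat.ceil (8 * (thm23Degree F x : ℝ) /
              ((C₀ * ((ε ^ 2 * δ / 2) / thm23Degree F x) ^ c) * δ))) (acceptPoly F x)).eval b -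
          evalBool (acceptPoly F x) b|).card : ℝ) ≤ δ * 2 ^ numOracleBits F x := by
  have hd1 : 1 ≤ thm23Degree F x := by unfold thm23Degree; omega
  have hTd : (F.circ x.length).oracleQueries ≤ thm23Degree F x := by unfold thm23Degree; omega
  have hdeg : (acceptPoly F x).totalDegree ≤ thm23Degree F x :=
    (totalDegree_acceptPoly_le F x).trans (by unfold thm23Degree; omega)
  exact (simTree_depth_error_le_pb hC₀ hd1 hTd
    (fun q ε' hq hε' hv => HPB _ _ q ε' hd1 hq hε' hv) hK hdeg hε hε1 hδ hδ1).2

/-- **The query half with a free error budget**: under PB-AA and `p_x ∈ K_{#gates}`, for `ε, δ ∈ (0,1]`,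
`μ {A | |tree(A) − p_x(A)| > ε} ≤ δ` over the random oracle (the relevant oracle bits are independent fair
coins, `randomOracleMeasure_oracleBits_mem`). [cite: AaronsonAmbainis2014, Thm. 21 and proof of Thm. 23 (p. 14)] -/
theorem measure_simTree_acceptPoly_deviation_le_pb (hC₀ : 0 < C₀)
    (HPB : ∀ (N T : ℕ) (p : MvPolynomial (Fin N) ℝ) (ε : ℝ), 1 ≤ T → PseudoBounded T p → 0 < ε →
      ε ≤ boolVariance p → ∃ i : Fin N, C₀ * (ε / T) ^ c ≤ influence i p)
    (hK : PseudoBounded (F.circ x.length).oracleQueries (acceptPoly F x))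
    {ε δ : ℝ} (hε : 0 < ε) (hε1 : ε ≤ 1) (hδ : 0 < δ) (hδ1 : δ ≤ 1) :
    randomOracleMeasure {A : Set (List Bool) | ε <
        |(simTree (ε ^ 2 * δ / 2) (C₀ * ((ε ^ 2 * δ / 2) / thm23Degree F x) ^ c)
            (Nat.ceil (8 * (thm23Degree F x : ℝ) /
              ((C₀ * ((ε ^ 2 * δ / 2) / thm23Degree F x) ^ c) * δ))) (acceptPoly F x)).eval
            (oracleBits F x A) - F.acceptProbOn A x|} ≤ ENNReal.ofReal δ := by
  classical
  set t := simTree (ε ^ 2 * δ / 2) (C₀ * ((ε ^ 2 * δ / 2) / thm23Degree F x) ^ c)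
    (Nat.ceil (8 * (thm23Degree F x : ℝ) / ((C₀ * ((ε ^ 2 * δ / 2) / thm23Degree F x) ^ c) * δ)))
    (acceptPoly F x) with ht
  have herr := card_simTree_acceptPoly_err_le_pb F x hC₀ HPB hK hε hε1 hδ hδ1
  rw [← ht] at herr
  have hset : {A : Set (List Bool) | ε < |t.eval (oracleBits F x A) - F.acceptProbOn A x|} =
      {A : Set (List Bool) |
        oracleBits F x A ∈ univ.filter fun b => ε < |t.eval b - evalBool (acceptPoly F x) b|} := by
    ext A
    simp only [Set.mem_setOf_eq, mem_filter, mem_univ, true_and, evalBool_acceptPoly]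
  rw [hset, randomOracleMeasure_oracleBits_mem]
  set S := univ.filter fun b : Fin (numOracleBits F x) → Bool =>
    ε < |t.eval b - evalBool (acceptPoly F x) b| with hS
  have hcard : (S.card : ℝ) ≤ δ * 2 ^ numOracleBits F x := herr
  have hmeas : (S.card : ℝ≥0∞) * 2⁻¹ ^ numOracleBits F x =
      ENNReal.ofReal ((S.card : ℝ) / 2 ^ numOracleBits F x) := by
    rw [ENNReal.ofReal_div_of_pos (by positivity), ENNReal.ofReal_natCast, ENNReal.ofReal_pow (by norm_num),
      ENNReal.ofReal_ofNat, ← ENNReal.inv_pow, div_eq_mul_inv]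
  rw [hmeas]
  refine ENNReal.ofReal_le_ofReal ?_
  rw [div_le_iff₀ (by positivity)]
  exact hcard

/-- **`Pr_A[|p̃_x(A) − p_x(A)| > 1/10] < 1/n³` for the tree's explicit tree `simTreeOn c C₀ F x`, under PB-AA**
(instead of Conjecture 6) and `p_x ∈ K_{#gates}`: the query half of claim (apx) of the proof of Thm. 23.
[cite: AaronsonAmbainis2014, Thm. 23 (proof, p. 14: claim (apx))] -/
theorem measure_simTreeOn_deviation_lt_pb (hC₀ : 0 < C₀)
    (HPB : ∀ (N T : ℕ) (p : MvPolynomial (Fin N) ℝ) (ε : ℝ), 1 ≤ T → PseudoBounded T p → 0 < ε →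
      ε ≤ boolVariance p → ∃ i : Fin N, C₀ * (ε / T) ^ c ≤ influence i p)
    (hK : PseudoBounded (F.circ x.length).oracleQueries (acceptPoly F x)) (hn : 1 ≤ x.length) :
    randomOracleMeasure {A : Set (List Bool) |
        1 / 10 < |(simTreeOn c C₀ F x).eval (oracleBits F x A) - F.acceptProbOn A x|} <
      ENNReal.ofReal (1 / (x.length : ℝ) ^ 3) := by
  have h := measure_simTree_acceptPoly_deviation_le_pb F x hC₀ HPB hK (by norm_num : (0 : ℝ) < 1 / 10)
    (by norm_num) (thm23Delta_pos hn) (thm23Delta_le_one hn)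
  refine lt_of_le_of_lt ?_ ((ENNReal.ofReal_lt_ofReal_iff (by have := thm23Delta_pos hn; positivity)).2
    (thm23Delta_lt hn))
  exact h

/-- **Thresholded form under PB-AA** (Cor. 22: "output `1` if `p̃ ≥ 1/2`"): the event of claim (apx) — the
`BQP` promise holds for `F^A` at `x` but the bit `[p̃_x(A) ≥ 1/2]` is not the promised answer — has
probability `< 1/n³`, granted PB-AA and `p_x ∈ K_{#gates}`. [cite: AaronsonAmbainis2014, Thm. 23 (proof, p. 14) with proof of Cor. 22] -/
theorem measure_simTreeOn_threshold_lt_pb (hC₀ : 0 < C₀)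
    (HPB : ∀ (N T : ℕ) (p : MvPolynomial (Fin N) ℝ) (ε : ℝ), 1 ≤ T → PseudoBounded T p → 0 < ε →
      ε ≤ boolVariance p → ∃ i : Fin N, C₀ * (ε / T) ^ c ≤ influence i p)
    (hK : PseudoBounded (F.circ x.length).oracleQueries (acceptPoly F x)) (hn : 1 ≤ x.length) :
    randomOracleMeasure {A : Set (List Bool) |
        (2 / 3 ≤ F.acceptProbOn A x ∧
            decide (1 / 2 ≤ (simTreeOn c C₀ F x).eval (oracleBits F x A)) ≠ true) ∨
          (F.acceptProbOn A x ≤ 1 / 3 ∧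
            decide (1 / 2 ≤ (simTreeOn c C₀ F x).eval (oracleBits F x A)) ≠ false)} <
      ENNReal.ofReal (1 / (x.length : ℝ) ^ 3) := by
  refine lt_of_le_of_lt (measure_mono fun A hA => ?_) (measure_simTreeOn_deviation_lt_pb F x hC₀ HPB hK hn)
  simp only [Set.mem_setOf_eq, ne_eq, decide_eq_true_eq, decide_eq_false_iff_not, not_le, not_lt] at hA ⊢
  rcases hA with ⟨hp, ht⟩ | ⟨hp, ht⟩
  · rw [abs_sub_comm, abs_of_nonneg (by linarith)]; linarith
  · rw [abs_of_nonneg (by linarith)]; linarith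

end SimTreePB

end Summit.QuantumAdvantage.QuantumAdvantage.Cruxes.TransferPB.Birth

end
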